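/-
Copyright (c) 2026. All rights reserved.
Released under Apache 2.0 license as described in the file LICENSE.
Authors: abc-iut cell, seat abc-iut-f-069 (gen 3; row «P13-VII-IX-OFOUTERACTION»).
-/
import Literature.AnabelianGeometry.AbsoluteAnabelian.AbsTopII.DPSCDataOfOuterActionInertia
import Literature.AnabelianGeometry.AbsoluteAnabelian.AbsTopII.InertiaDecompositionBranch

/-!
# [AbsTopII] Prop 1.3 (vii), (ix) at `Π_𝒢 ⋊^out_θ J`: the (ii)-clauses DISCHARGED from Dehn-type `ρ_I`
# and abelian edge groups

S. Mochizuki, *Topics in Absolute Anabelian Geometry II* [AbsTopII] (bib `MochizukiAbsTopII2013`; kurims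
manuscript `paper:url-585b8d0ad0d9`), §1 Def 1.2 (ii) p. 10, Prop 1.3 (ii) p. 11 ("a natural exact sequence
`1 → Π_e → I_e → I → 1`"), (vii), (ix) p. 12, proofs p. 13 / pp. 18–19; [CombGC] (bib `MochizukiCombGC2007`)
Def 1.1 (ii), Rmk 1.1.3 ("every edge-like subgroup … isomorphic to `Ẑ^Σ`", in particular abelian),
Prop 1.2 (i)(ii) p. 8.

PROOF-ONLY (no definition) over abc-iut-w5-d226's `DPSCData.ofOuterAction`, `prop13vii_ofOuterAction`,
`prop13ix_ofOuterAction` (`AbsTopII/DPSCDataOfOuterAction.lean`) — whose residual hypotheses `hii`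
(the Prop 1.3 (ii) clauses "`Π_e ⊆ I_e`", "`I_e · Π_𝔾 = Π_I`" for every node) and `hab` (cusp groups abelian)
are here REDUCED to hypotheses on the CONSTRUCTION DATA:

* `DPSCData.exists_fixingLift_of_le_conjAct_smul` — a lift of `θ(i)` fixing `L` pointwise yields, for
  `K ⊆ γ·L·γ⁻¹`, a lift IN THE SAME OUTER CLASS fixing `K` pointwise (inner correction by `γ`);
* `DPSCData.centralizer_map_inl_sup_PiG_eq_PiI` — for ANY `K ⊆ Π_𝒢` fixed pointwise by lifts of `ρ_I`,
  `(Z_{Π_H}(inl K) ∩ Π_I) · Π_𝔾 = Π_I` (generalises abc-iut-w5-d226's `Iv_sup_PiG_eq_PiI_ofOuterAction`,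
  `K = Π_v`, p441781 — the decl of record for I-surj);
* `DPSCData.prop13ii_clauses_ofOuterAction_of_dehn` — for every node `e`: "`Π_e ⊆ I_e`" from `Π_e`
  abelian, and "`I_e · Π_𝔾 = Π_I`" from Π_v-fixing lifts of `ρ_I` at the branch vertices (L3's
  `PSCDatum.nodeGp_le`: `γΠ_eγ⁻¹ ⊆ Π_v`, so a Π_v-fixing Dehn-type lift is corrected to a Π_e-fixing one);
* closers `DPSCData.prop13vii_ofOuterAction_of_dehn` — **[AbsTopII] Prop 1.3 (vii) AS TYPED (F-0280) at
  `Π_𝒢 ⋊^out_θ J` from {graphic lifts of `θ`, F-0438, F-0459 (edges), node groups abelian, Π_v-fixing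
  lifts of `ρ_I`}** and `DPSCData.prop13ix_ofOuterAction_of_abelian` — **(ix) AS TYPED (F-0277) from
  {`Π_𝒢` slim non-trivial, graphic lifts, F-0438, edge groups abelian}** — no `Π_I`-level residue.
HONEST FRAMING: classical group theory; the named inputs stay hypotheses (typed ≠ proved); nothing here
bears on [IUTchIII] Cor 3.12 or takes a side on any author.
-/

noncomputable section

open scoped Pointwise

namespace Literature.AnabelianGeometry.AbsoluteAnabelian

open Literature.AlgebraicGeometry.Frobenioids (IsSlimGroup)
open Literature.AnabelianGeometry.EtaleTheta (contMulAut mem_contMulAut TopOut innerContAut innerAut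
  innerAut_le_contMulAut)
open Literature.AnabelianGeometry.SemiGraphs
open Topology

universe u

namespace DPSCData

section OuterAction

variable {P : Type u} [Group P] [TopologicalSpace P] [IsTopologicalGroup P] [CompactSpace P]
  [TotallyDisconnectedSpace P] (G : PSCDatum P) (hG : IsTopologicallyFinitelyGenerated P)
  {J : Type u} [Group J] [TopologicalSpace J] [IsTopologicalGroup J] [CompactSpace J]
  [TotallyDisconnectedSpace J] (θ : J →ₜ* outProfinite hG) (I : Subgroup J) [I.Normal]

omit [CompactSpace P] [TotallyDisconnectedSpace P] in
/-- **Inner correction of a fixing lift**: if an outer class has a bi-continuous lift `φ` fixing `L`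
pointwise and `K ⊆ γ·L·γ⁻¹`, then it has a lift fixing `K` pointwise, namely `inn(γ) ∘ φ ∘ inn(γ)⁻¹`
(same outer class).  Used to pass a Π_v-fixing profinite Dehn twist to a Π_e-fixing one along a branch
`Π_e ↪ Π_v` ([CombGC] Def 1.1 (ii)). [cite: MochizukiCombGC2007, Def 1.1(ii) p.7] -/
theorem exists_fixingLift_of_le_conjAct_smul {K L : Subgroup P} {γ : ConjAct P}
    (hKL : K ≤ γ • L) {ω : TopOut P}
    (h : ∃ φ : P ≃ₜ* P,
      TopOut.mk P ⟨φ.toMulEquiv, (mem_contMulAut P).mpr ⟨φ.continuous, φ.symm.continuous⟩⟩ = ω ∧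
        ∀ x ∈ L, φ x = x) :
    ∃ ψ : P ≃ₜ* P,
      TopOut.mk P ⟨ψ.toMulEquiv, (mem_contMulAut P).mpr ⟨ψ.continuous, ψ.symm.continuous⟩⟩ = ω ∧
        ∀ x ∈ K, ψ x = x := by
  obtain ⟨φ, hφ, hfix⟩ := h
  -- conjugation by `g := γ` as a bi-continuous automorphism
  set g : P := ConjAct.ofConjAct γ with hg
  have hcγ : MulAut.conj g ∈ contMulAut P := innerAut_le_contMulAut P ⟨g, rfl⟩
  let cγ : P ≃ₜ* P :=
    { MulAut.conj g with continuous_toFun := hcγ.1, continuous_invFun := hcγ.2 }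
  refine ⟨(cγ.symm.trans φ).trans cγ, ?_, fun x hx => ?_⟩
  · -- same outer class: `inn(g) · φ · inn(g)⁻¹ ≡ φ` modulo inner automorphisms
    rw [← hφ]
    set c : contMulAut P := ⟨φ.toMulEquiv, (mem_contMulAut P).mpr ⟨φ.continuous, φ.symm.continuous⟩⟩
      with hc
    have hinner : (⟨MulAut.conj g, hcγ⟩ : contMulAut P) ∈ innerContAut P :=
      Subgroup.mem_subgroupOf.mpr ⟨g, rfl⟩
    have h1 : TopOut.mk P ⟨MulAut.conj g, hcγ⟩ = 1 := (QuotientGroup.eq_one_iff _).mpr hinner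
    have heq : (⟨((cγ.symm.trans φ).trans cγ).toMulEquiv, (mem_contMulAut P).mpr
        ⟨((cγ.symm.trans φ).trans cγ).continuous, ((cγ.symm.trans φ).trans cγ).symm.continuous⟩⟩ :
          contMulAut P) = ⟨MulAut.conj g, hcγ⟩ * c * (⟨MulAut.conj g, hcγ⟩)⁻¹ := by
      apply Subtype.ext
      apply MulEquiv.ext
      intro x
      rfl
    rw [heq, map_mul, map_mul, map_inv, h1, one_mul, inv_one, mul_one]
  · -- `ψ (g l g⁻¹) = g φ(l) g⁻¹ = g l g⁻¹`
    obtain ⟨l, hl, rfl⟩ := (Subgroup.mem_smul_pointwise_iff_exists x _ L).mp (hKL hx)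
    show g * φ (g⁻¹ * (γ • l) * g) * g⁻¹ = γ • l
    rw [ConjAct.smul_def, ← hg, show g⁻¹ * (g * l * g⁻¹) * g = l by group, hfix l hl]

/-- **The I-surj argument for an arbitrary pointwise-fixed subgroup**: if every `i ∈ I` has a bi-continuous
lift of `θ(i)` fixing `K ⊆ Π_𝒢` pointwise, then `(Z_{Π_H}(inl K) ∩ Π_I) · Π_𝔾 = Π_I` in `Π_H = Π_𝒢 ⋊^out_θ J`
(for `y ∈ Π_I` over `i`, the `Aut`-component of `y` differs from the lift by an inner `conj p`, and
`inl(φ p)⁻¹ · y` centralises `inl K`).  `K = Π_v`: abc-iut-w5-d226's `Iv_sup_PiG_eq_PiI_ofOuterAction`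
(p441781, decl of record for "`I_v ↠ I`"); `K = Π_e`: "`I_e ↠ I`" of Prop 1.3 (ii).
[cite: MochizukiAbsTopII2013, Prop 1.3 (ii) p.11] -/
theorem centralizer_map_inl_sup_PiG_eq_PiI (K : Subgroup P)
    (hK : ∀ i ∈ I, ∃ φ : P ≃ₜ* P,
      TopOut.mk P ⟨φ.toMulEquiv, (mem_contMulAut P).mpr ⟨φ.continuous, φ.symm.continuous⟩⟩ =
        outerActionOfContinuous hG θ i ∧ ∀ x ∈ K, φ x = x) :
    (Subgroup.centralizer (((K.map (inlProfinite hG θ).toMonoidHom : Subgroup (ofOuterAction G hG θ I).PiH)) :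
        Set (ofOuterAction G hG θ I).PiH) ⊓ (ofOuterAction G hG θ I).PiI) ⊔ (ofOuterAction G hG θ I).PiG =
      (ofOuterAction G hG θ I).PiI := by
  apply le_antisymm (sup_le inf_le_right (ofOuterAction G hG θ I).PiG_le_PiI)
  intro y₀ hy
  obtain ⟨y, rfl⟩ : ∃ y : outerSemidirectProfinite hG θ, y = y₀ := ⟨y₀, rfl⟩
  have hyI : sndProfinite hG θ y ∈ I := hy
  obtain ⟨φ, hφ, hfix⟩ := hK _ hyI
  obtain ⟨p, hp⟩ := exists_conjAutOf_eq_of_lift hG θ y φ hφ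
  have hconj : ∀ x, conjAutOf hG θ y x = φ p * φ x * (φ p)⁻¹ := fun x => by
    rw [hp x, map_mul, map_mul, map_inv]
  set q : P := φ p with hq
  set h : outerSemidirectProfinite hG θ := (inlProfinite hG θ q)⁻¹ * y with hh
  have hcomm : ∀ x ∈ K, h * inlProfinite hG θ x * h⁻¹ = inlProfinite hG θ x := by
    intro x hx
    have e1 : y * inlProfinite hG θ x * y⁻¹ = inlProfinite hG θ (q * φ x * q⁻¹) := by
      rw [← hconj x, inlProfinite_conjAutOf]
    have e2 : h * inlProfinite hG θ x * h⁻¹ =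
        (inlProfinite hG θ q)⁻¹ * (y * inlProfinite hG θ x * y⁻¹) * inlProfinite hG θ q := by
      rw [hh, mul_inv_rev, inv_inv]
      group
    rw [e2, e1, ← map_inv, ← map_mul, ← map_mul, hfix x hx]
    congr 1
    group
  have hhI : h ∈ Subgroup.centralizer (((K.map (inlProfinite hG θ).toMonoidHom :
      Subgroup (ofOuterAction G hG θ I).PiH)) : Set (ofOuterAction G hG θ I).PiH) ⊓ (ofOuterAction G hG θ I).PiI := by
    refine Subgroup.mem_inf.mpr ⟨?_, ?_⟩
    · refine Subgroup.mem_centralizer_iff.mpr (fun m hm => ?_)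
      obtain ⟨x, hx, rfl⟩ := Subgroup.mem_map.mp hm
      show inlProfinite hG θ x * h = h * inlProfinite hG θ x
      have e3 := hcomm x hx
      calc inlProfinite hG θ x * h = h * inlProfinite hG θ x * h⁻¹ * h := by rw [e3]
        _ = h * inlProfinite hG θ x := by rw [inv_mul_cancel_right]
    · show sndProfinite hG θ h ∈ I
      rw [hh, map_mul, map_inv, sndProfinite_inlProfinite, inv_one, one_mul]
      exact hyI
  have hy' : y = inlProfinite hG θ q * h := by rw [hh, mul_inv_cancel_left]
  rw [hy', sup_comm]
  exact Subgroup.mul_mem_sup ⟨q, rfl⟩ hhI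

omit [TopologicalSpace P] [IsTopologicalGroup P] [CompactSpace P] [TotallyDisconnectedSpace P] in
/-- A pointwise-abelian subgroup stays abelian under a homomorphism, phrased as "the image lies in its own
centraliser" — "`Π_e ⊆ Z(Π_e)`" for the abelian edge groups of [CombGC] Rmk 1.1.3.
[cite: MochizukiCombGC2007, Rmk 1.1.3 p.7] -/
theorem map_le_centralizer_map_of_comm {E : Type u} [Group E] (f : P →* E) {K : Subgroup P}
    (hK : ∀ x ∈ K, ∀ y ∈ K, x * y = y * x) :
    K.map f ≤ Subgroup.centralizer ((K.map f : Subgroup E) : Set E) := by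
  rintro _ ⟨x, hx, rfl⟩
  refine Subgroup.mem_centralizer_iff.mpr ?_
  rintro _ ⟨y, hy, rfl⟩
  rw [← map_mul, ← map_mul, hK y hy x hx]

/-- **The Prop 1.3 (ii) clauses at `Π_𝒢 ⋊^out_θ J` for every node** — "`Π_e ⊆ I_e`" and "`I_e · Π_𝔾 = Π_I`"
(`I_e ↠ I`), the hypothesis `hii` of abc-iut-w5-d226's `prop13vii_ofOuterAction` — from: node groups
abelian ([CombGC] Rmk 1.1.3) and Π_v-fixing lifts of `ρ_I` (profinite Dehn twists), via L3's branch datum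
`PSCDatum.nodeGp_le` (`γΠ_eγ⁻¹ ⊆ Π_v`) and the inner correction `exists_fixingLift_of_le_conjAct_smul`.
[cite: MochizukiAbsTopII2013, Prop 1.3 (ii) p.11] [cite: MochizukiCombGC2007, Def 1.1(ii) p.7] -/
theorem prop13ii_clauses_ofOuterAction_of_dehn
    (hnab : ∀ (e : G.graph.N), ∀ x ∈ G.nodeGp e, ∀ y ∈ G.nodeGp e, x * y = y * x)
    (hDehn : ∀ (v : G.graph.V) (i : J), i ∈ I → ∃ φ : P ≃ₜ* P,
      TopOut.mk P ⟨φ.toMulEquiv, (mem_contMulAut P).mpr ⟨φ.continuous, φ.symm.continuous⟩⟩ =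
        outerActionOfContinuous hG θ i ∧ ∀ x ∈ G.vertGp v, φ x = x)
    (n : (ofOuterAction G hG θ I).Node) :
    (ofOuterAction G hG θ I).nodeSub n ≤ (ofOuterAction G hG θ I).IvNode n ∧
      (ofOuterAction G hG θ I).IvNode n ⊔ (ofOuterAction G hG θ I).PiG = (ofOuterAction G hG θ I).PiI := by
  refine ⟨le_inf (map_le_centralizer_map_of_comm (inlProfinite hG θ).toMonoidHom (hnab n.down))
    (((ofOuterAction G hG θ I).nodeSub_le n).trans (ofOuterAction G hG θ I).PiG_le_PiI), ?_⟩
  -- a branch `γΠ_eγ⁻¹ ⊆ Π_{v₁}` of the node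
  obtain ⟨v₁, v₂, -, ⟨γ, hγ⟩, -⟩ := G.nodeGp_le n.down
  have hKL : G.nodeGp n.down ≤ γ⁻¹ • G.vertGp v₁ := Subgroup.pointwise_smul_subset_iff.mp hγ
  exact centralizer_map_inl_sup_PiG_eq_PiI G hG θ I (G.nodeGp n.down) fun i hi =>
    exists_fixingLift_of_le_conjAct_smul hKL (hDehn v₁ i hi)

/-- **[AbsTopII] Prop 1.3 (vii) AS TYPED (F-0280, abc-iut-L4-t4's `DPSCData.Prop13vii`) at `Π_𝒢 ⋊^out_θ J`
from hypotheses on the CONSTRUCTION DATA only**: graphic lifts of `θ` (Def 1.2 (ii)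
"`Aut(𝒢) ⊆ Out(Π_𝒢)`"), [CombGC] Prop 1.2 (ii) (F-0438) and (i) for edges (F-0459) for `G`, node groups
abelian (Rmk 1.1.3), Π_v-fixing lifts of `ρ_I` (profinite Dehn twists) — abc-iut-w5-d226's
`prop13vii_ofOuterAction` with `hii` DISCHARGED. [cite: MochizukiAbsTopII2013, Prop 1.3 (vii) p.12]
[cite: MochizukiCombGC2007, Prop 1.2 p.8] -/
theorem prop13vii_ofOuterAction_of_dehn (hZ : Subgroup.center P = ⊥)
    (hθ : ∀ j : J, ∃ φ : P ≃ₜ* P,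
      TopOut.mk P ⟨φ.toMulEquiv, (mem_contMulAut P).mpr ⟨φ.continuous, φ.symm.continuous⟩⟩ =
        outerActionOfContinuous hG θ j ∧ G.IsGraphic G φ)
    (hCT : G.VerticialEdgeLikeCommensurablyTerminal) (hDet : G.EdgeLikeOpenInterDeterminesEdge)
    (hnab : ∀ (e : G.graph.N), ∀ x ∈ G.nodeGp e, ∀ y ∈ G.nodeGp e, x * y = y * x)
    (hDehn : ∀ (v : G.graph.V) (i : J), i ∈ I → ∃ φ : P ≃ₜ* P,
      TopOut.mk P ⟨φ.toMulEquiv, (mem_contMulAut P).mpr ⟨φ.continuous, φ.symm.continuous⟩⟩ =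
        outerActionOfContinuous hG θ i ∧ ∀ x ∈ G.vertGp v, φ x = x) :
    (ofOuterAction G hG θ I).Prop13vii :=
  prop13vii_ofOuterAction G hG hZ θ I (isGraphic_conjAutOf_of_lifts G hG θ hθ) hCT hDet
    (prop13ii_clauses_ofOuterAction_of_dehn G hG θ I hnab hDehn)

/-- **[AbsTopII] Prop 1.3 (ix) AS TYPED (F-0277, abc-iut-L4-t4's `DPSCData.Prop13ix`) at `Π_𝒢 ⋊^out_θ J`
from hypotheses on the CONSTRUCTION DATA only**: `Π_𝒢` slim and non-trivial ([CombGC] Rmk 1.1.3), graphic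
lifts of `θ`, [CombGC] Prop 1.2 (ii) (F-0438), edge groups (nodes and cusps) abelian (Rmk 1.1.3
"`≅ Ẑ^Σ`") — abc-iut-w5-d226's `prop13ix_ofOuterAction` with `hii`, `hab` DISCHARGED; no inertia input is
needed for (ix). [cite: MochizukiAbsTopII2013, Prop 1.3 (ix) p.12] [cite: MochizukiCombGC2007, Prop 1.2 p.8] -/
theorem prop13ix_ofOuterAction_of_abelian [Nontrivial P] (hZ : Subgroup.center P = ⊥) (hslim : IsSlimGroup P)
    (hθ : ∀ j : J, ∃ φ : P ≃ₜ* P,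
      TopOut.mk P ⟨φ.toMulEquiv, (mem_contMulAut P).mpr ⟨φ.continuous, φ.symm.continuous⟩⟩ =
        outerActionOfContinuous hG θ j ∧ G.IsGraphic G φ)
    (hCT : G.VerticialEdgeLikeCommensurablyTerminal)
    (hnab : ∀ (e : G.graph.N), ∀ x ∈ G.nodeGp e, ∀ y ∈ G.nodeGp e, x * y = y * x)
    (hcab : ∀ (c : G.graph.C), ∀ x ∈ G.cuspGp c, ∀ y ∈ G.cuspGp c, x * y = y * x) :
    (ofOuterAction G hG θ I).Prop13ix := by
  refine prop13ix_ofOuterAction G hG hZ θ I hslim (isGraphic_conjAutOf_of_lifts G hG θ hθ) hCT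
    (fun n => le_inf (map_le_centralizer_map_of_comm (inlProfinite hG θ).toMonoidHom (hnab n.down))
      (((ofOuterAction G hG θ I).nodeSub_le n).trans (ofOuterAction G hG θ I).PiG_le_PiI)) ?_
  rintro c _ ⟨x, hx, rfl⟩ _ ⟨y, hy, rfl⟩
  show (inlProfinite hG θ).toMonoidHom x * (inlProfinite hG θ).toMonoidHom y =
    (inlProfinite hG θ).toMonoidHom y * (inlProfinite hG θ).toMonoidHom x
  rw [← map_mul, ← map_mul, hcab c.down x hx y hy]

end OuterAction

end DPSCData

end Literature.AnabelianGeometry.AbsoluteAnabelian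

end
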